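import Summits.KontsevichZagierPeriods.Zeta5Search.Certificates.PolyReflectPack
import HarnessLib

/-!
# ζ(5) search — module reduction: TWO-KILL elimination steps and runs (symbolic, packed, shadow) (cell `pub-zeta5`, certifier `cert-2`)

HONEST FRAMING: systematic search; recurrence certificates; no irrationality claim unless certified.

Two-kill elimination steps `elimStep2 a R₁ s₁ R₂ s₂ E = a•E − E[s₁]•R₁ − E[s₂]•R₂` (both killed coefficients read from the
original `E`; a one-kill step uses the empty relation) and runs `elimRun2`, with the three companions the engine needs:
soundness `lcEval_elimRun2` (`= (∏ multipliers) · lcEval E` — no pivot condition in this direction), the packed run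
`elimRun2Z` with `packLC_elimRun2`, and the shadow `elimShadow2` with `lcFits_elimRun2`. Used by the coordinate form
(`PolyReflectCoord`): per-symbol reduction paths in tensor modules, where one factor-2 step kills the two factor-1
basis partners at once.
-/

namespace Summit.KontsevichZagierPeriods.Zeta5Search.PolyReflect

/-! ### Two-kill elimination steps and runs -/

/-- `a•E − E[s₁]•R₁ − E[s₂]•R₂` (both killed coefficients are read from the ORIGINAL `E`). -/
def elimStep2 (a : Poly3) (R₁ : LC) (s₁ : ℕ) (R₂ : LC) (s₂ : ℕ) (E : LC) : LC :=
  lcAdd (lcAdd (lcSmul a E) (lcSmul (neg3 (lcGet E s₁)) R₁)) (lcSmul (neg3 (lcGet E s₂)) R₂)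

/-- A run of two-kill steps `(r₁, s₁, r₂, s₂, a)` (relation indices into `rels`; an out-of-range index is the empty
relation, i.e. a one-kill step). -/
def elimRun2 (rels : List LC) : List (ℕ × ℕ × ℕ × ℕ × Poly3) → LC → LC
  | [], E => E
  | (r₁, s₁, r₂, s₂, a) :: st, E => elimRun2 rels st (elimStep2 a (rels.getD r₁ []) s₁ (rels.getD r₂ []) s₂ E)

/-- The multipliers of a run. -/
def mults2 : List (ℕ × ℕ × ℕ × ℕ × Poly3) → List Poly3
  | [] => []
  | (_, _, _, _, a) :: st => a :: mults2 st

/-- Soundness of one step: relations evaluate to `0` ⇒ the value is multiplied by the multiplier. -/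
theorem lcEval_elimStep2 (T : ℕ → ℚ) (w x k : ℚ) (a : Poly3) (R₁ : LC) (s₁ : ℕ) (R₂ : LC) (s₂ : ℕ) (E : LC)
    (h₁ : lcEval T w x k 0 R₁ = 0) (h₂ : lcEval T w x k 0 R₂ = 0) :
    lcEval T w x k 0 (elimStep2 a R₁ s₁ R₂ s₂ E) = ev3 a w x k * lcEval T w x k 0 E := by
  simp [elimStep2, lcEval_lcAdd, lcEval_lcSmul, h₁, h₂]

/-- **Soundness of a run**: `lcEval (elimRun2 rels st E) = (∏ multipliers) · lcEval E`. -/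
theorem lcEval_elimRun2 (T : ℕ → ℚ) (w x k : ℚ) (rels : List LC) (h : ∀ R ∈ rels, lcEval T w x k 0 R = 0) :
    ∀ (st : List (ℕ × ℕ × ℕ × ℕ × Poly3)) (E : LC),
      lcEval T w x k 0 (elimRun2 rels st E) = ((mults2 st).map fun p => ev3 p w x k).prod * lcEval T w x k 0 E
  | [], E => by simp [elimRun2, mults2]
  | (r₁, s₁, r₂, s₂, a) :: st, E => by
    rw [elimRun2, lcEval_elimRun2 T w x k rels h st, mults2, List.map_cons, List.prod_cons,
      lcEval_elimStep2 T w x k a _ s₁ _ s₂ E (lcEval_getD_eq_zero h r₁)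
        (lcEval_getD_eq_zero h r₂)]
    ring

/-! ### Packed two-kill runs (big integers) -/

/-- Packed two-kill step. -/
def elimStep2Z (a : ℤ) (R₁ : List ℤ) (s₁ : ℕ) (R₂ : List ℤ) (s₂ : ℕ) (E : List ℤ) : List ℤ :=
  zAdd (zAdd (zSmul a E) (zSmul (-(zGet E s₁)) R₁)) (zSmul (-(zGet E s₂)) R₂)

/-- Packed two-kill run. -/
def elimRun2Z (w x k : ℤ) (rels : List (List ℤ)) : List (ℕ × ℕ × ℕ × ℕ × Poly3) → List ℤ → List ℤ
  | [], E => E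
  | (r₁, s₁, r₂, s₂, a) :: st, E =>
    elimRun2Z w x k rels st (elimStep2Z (evZ3 a w x k) (rels.getD r₁ []) s₁ (rels.getD r₂ []) s₂ E)

/-- `packLC` of `neg3`-multiples. -/
theorem packLC_lcSmul_neg3 (w x k : ℤ) (c : Poly3) (E : LC) :
    packLC w x k (lcSmul (neg3 c) E) = zSmul (-(evZ3 c w x k)) (packLC w x k E) := by
  rw [packLC_lcSmul, evZ3_neg3]

/-- Packing commutes with a two-kill step. -/
theorem packLC_elimStep2 (w x k : ℤ) (a : Poly3) (R₁ : LC) (s₁ : ℕ) (R₂ : LC) (s₂ : ℕ) (E : LC) :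
    packLC w x k (elimStep2 a R₁ s₁ R₂ s₂ E) =
      elimStep2Z (evZ3 a w x k) (packLC w x k R₁) s₁ (packLC w x k R₂) s₂ (packLC w x k E) := by
  simp only [elimStep2, elimStep2Z, packLC_lcAdd, packLC_lcSmul, evZ3_neg3, zGet_packLC]

/-- `getD` commutes with `map packLC`. -/
theorem getD_map_packLC (w x k : ℤ) : ∀ (rels : List LC) (r : ℕ),
    (rels.map (packLC w x k)).getD r [] = packLC w x k (rels.getD r [])
  | [], r => by simp [packLC]
  | R :: rels, 0 => by simp
  | R :: rels, r + 1 => by simpa using getD_map_packLC w x k rels r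

/-- **Packing commutes with a two-kill run.** -/
theorem packLC_elimRun2 (w x k : ℤ) (rels : List LC) :
    ∀ (st : List (ℕ × ℕ × ℕ × ℕ × Poly3)) (E : LC),
      packLC w x k (elimRun2 rels st E) = elimRun2Z w x k (rels.map (packLC w x k)) st (packLC w x k E)
  | [], E => rfl
  | (r₁, s₁, r₂, s₂, a) :: st, E => by
    rw [elimRun2, elimRun2Z, packLC_elimRun2 w x k rels st, packLC_elimStep2, getD_map_packLC, getD_map_packLC]

/-! ### Shadow of two-kill runs -/

/-- One two-kill step: `E` fits `(W,X,H)`, `a :: R₁ ++ R₂` fits `(WR,XR,HR)` ⇒ the result fits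
`(WR+W−1, XR+X−1, 3·HR·H)`. -/
theorem lcFits_elimStep2 {W X H WR XR HR : ℕ} (hW : 1 ≤ W) (hX : 1 ≤ X) (hWR : 1 ≤ WR) (hXR : 1 ≤ XR)
    (a : Poly3) (R₁ : LC) (s₁ : ℕ) (R₂ : LC) (s₂ : ℕ) (E : LC)
    (hE : ∀ c ∈ E, (∀ b ∈ c, b.length ≤ X ∧ ∀ r ∈ b, r.length ≤ W) ∧ norm3 c ≤ H)
    (hR : ∀ c ∈ a :: (R₁ ++ R₂), (∀ b ∈ c, b.length ≤ XR ∧ ∀ r ∈ b, r.length ≤ WR) ∧ norm3 c ≤ HR) :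
    ∀ c ∈ elimStep2 a R₁ s₁ R₂ s₂ E, (∀ b ∈ c, b.length ≤ XR + X - 1 ∧ ∀ r ∈ b, r.length ≤ WR + W - 1) ∧
      norm3 c ≤ 3 * (HR * H) := by
  have ha := hR a (by simp)
  have hR₁ : ∀ c ∈ R₁, (∀ b ∈ c, b.length ≤ XR ∧ ∀ r ∈ b, r.length ≤ WR) ∧ norm3 c ≤ HR :=
    fun c hc => hR c (by simp [hc])
  have hR₂ : ∀ c ∈ R₂, (∀ b ∈ c, b.length ≤ XR ∧ ∀ r ∈ b, r.length ≤ WR) ∧ norm3 c ≤ HR :=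
    fun c hc => hR c (by simp [hc])
  have hc₁ := lcFits_get E s₁ hE
  have hc₂ := lcFits_get E s₂ hE
  have h1 := lcFits_smul ⟨hWR, hXR⟩ ⟨hW, hX⟩ a ha.1 ha.2 E hE
  have h2 := lcFits_smul ⟨hW, hX⟩ ⟨hWR, hXR⟩ (neg3 (lcGet E s₁)) (sh3_neg3 hW hX _ hc₁.1)
    ((norm3_neg3 _).trans hc₁.2) R₁ hR₁
  have h3 := lcFits_smul ⟨hW, hX⟩ ⟨hWR, hXR⟩ (neg3 (lcGet E s₂)) (sh3_neg3 hW hX _ hc₂.1)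
    ((norm3_neg3 _).trans hc₂.2) R₂ hR₂
  rw [show W + WR - 1 = WR + W - 1 by omega, show X + XR - 1 = XR + X - 1 by omega,
    show H * HR = HR * H by ring] at h2 h3
  have h12 := lcFits_add _ _ h1 h2
  have := lcFits_add _ _ h12 h3
  rw [elimStep2]
  intro c hc
  have hc' := this c hc
  exact ⟨hc'.1, hc'.2.trans (by omega)⟩

/-- The shadow of a two-kill run. -/
def elimShadow2 (rels : List LC) : List (ℕ × ℕ × ℕ × ℕ × Poly3) → ℕ × ℕ × ℕ → ℕ × ℕ × ℕ
  | [], S => S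
  | (r₁, _, r₂, _, a) :: st, (W, X, H) =>
    let m := lcMeasure (a :: (rels.getD r₁ [] ++ rels.getD r₂ []))
    elimShadow2 rels st (m.1 + W - 1, m.2.1 + X - 1, 3 * (m.2.2 * H))

/-- **Soundness of the shadow** of a two-kill run. -/
theorem lcFits_elimRun2 (rels : List LC) :
    ∀ (st : List (ℕ × ℕ × ℕ × ℕ × Poly3)) (E : LC) (W X H : ℕ), 1 ≤ W → 1 ≤ X →
      (∀ c ∈ E, (∀ b ∈ c, b.length ≤ X ∧ ∀ r ∈ b, r.length ≤ W) ∧ norm3 c ≤ H) →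
      ∀ c ∈ elimRun2 rels st E, (∀ b ∈ c, b.length ≤ (elimShadow2 rels st (W, X, H)).2.1 ∧
        ∀ r ∈ b, r.length ≤ (elimShadow2 rels st (W, X, H)).1) ∧ norm3 c ≤ (elimShadow2 rels st (W, X, H)).2.2
  | [], E, W, X, H, _, _, h => by simpa [elimShadow2, elimRun2] using h
  | (r₁, s₁, r₂, s₂, a) :: st, E, W, X, H, hW, hX, h => by
    have hm := one_le_lcMeasure (a :: (rels.getD r₁ [] ++ rels.getD r₂ []))
    have hR := lcFits_measure (a :: (rels.getD r₁ [] ++ rels.getD r₂ []))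
    simp only [elimShadow2, elimRun2]
    exact lcFits_elimRun2 rels st _ _ _ _ (by omega) (by omega)
      (lcFits_elimStep2 hW hX hm.1 hm.2.1 a _ s₁ _ s₂ E h hR)

/-- The shape components of the shadow stay `≥ 1`. -/
theorem one_le_elimShadow2 (rels : List LC) : ∀ (st : List (ℕ × ℕ × ℕ × ℕ × Poly3)) (W X H : ℕ), 1 ≤ W → 1 ≤ X →
    1 ≤ (elimShadow2 rels st (W, X, H)).1 ∧ 1 ≤ (elimShadow2 rels st (W, X, H)).2.1
  | [], W, X, H, hW, hX => by simpa [elimShadow2] using ⟨hW, hX⟩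
  | (r₁, s₁, r₂, s₂, a) :: st, W, X, H, hW, hX => by
    simp only [elimShadow2]
    have hm := one_le_lcMeasure (a :: (rels.getD r₁ [] ++ rels.getD r₂ []))
    exact one_le_elimShadow2 rels st _ _ _ (by omega) (by omega)

end Summit.KontsevichZagierPeriods.Zeta5Search.PolyReflect
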